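import Mathlib
import HarnessLib
import HarnessLib.Audit
import Summits.Langlands.Statement

/-!
Route: SelfDefeatingInduction

Route SelfDefeatingInduction — realises idea card
Langlands/Langlands/self-defeating-induction-exotic-weights.

THESIS X (it suffices to show). Fix a CM field K and a quadratic extension F/K that is NOT CM (so
F_cm = K; e.g. F = ℚ(2^{1/4}, i) over K = ℚ(√2, i); the case "index-2 totally real subfield" reduces
to this one by adjoining √−d, support item TotallyRealBaseReduction). Let σ generate Gal(F/K). For
an irreducible geometric ρ : Γ_F → GL_n(ℚ̄_ℓ) call a fibre {τ, τσ} of Hom(F, ℚ̄_ℓ) → Hom(K, ℚ̄_ℓ)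
DESCENDED if HT_τ(ρ) = HT_{τσ}(ρ) and EXOTIC if HT_τ(ρ) ∩ HT_{τσ}(ρ) = ∅ (for n ≤ 2 every fibre is
one or the other: det ρ is a geometric character, Weil). X := X_exo ∧ X_rest, where
 • X_exo (item NoOrdinaryExoticRho — the route's theorem): there is NO ρ with every fibre exotic
which is (ii) ordinary with regular Hodge–Tate weights at each v | ℓ (Qian2022 Def. 1.2), (iv)
ℓ-SPLIT and (v) NESTED — every place w | ℓ of K splits in F and the interleaving pattern of HT_τ(ρ)
versus HT_{τσ}(ρ) is constant on Hom(K_w, ℚ̄_ℓ) (by support item LocalOrdinarityOfInduction these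
are EXACTLY the conditions for Ind_{Γ_F}^{Γ_K} ρ to be ordinary; they cannot be weakened inside this
mechanism) — and (vi) whose induced residual representation Ind ρ̄ : Γ_K → GL_{2n}(F̄_ℓ) satisfies
Qian's bigness hypotheses (absolutely irreducible, decomposed generic, enormous on Γ_{K(ζ_ℓ)}, a
scalar element outside Γ_{K(ζ_ℓ)});
 • X_rest (item OffSectorReciprocity): the summit statement with clause (B) over such F demanded
only OFF that sector — the rest of the mountain, shared with every other route (the DESCENDED sector
over these very fields is the business of cards quadratic-window-unitary-lds /
unitary-lds-patching-window).
ASSEMBLY: X_exo → X_rest → Langlands is a case split on ρ; typed today as the skeleton `Assembly`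
(quantified over the sector predicate, lean check rc 0, provable now), because labelled Hodge–Tate
weights, ordinarity, induction of Galois representations and enormous image are not yet in the tree
(ReciprocityGLn design note; definition requests filed with this route).

MECHANISM of X_exo (self-defeating induction; two pages given the imports): exotic + ℓ-split +
nested ⇒ R := Ind_{Γ_F}^{Γ_K} ρ is Hodge–Tate regular (HT_{τ₀}(R) = HT_τ ⊔ HT_{τσ}), ordinary,
absolutely irreducible (ρ ≇ ρ^σ since the weights differ), geometric ⇒ [crux
QianPotentialAutomorphyInput = Qian2022 Thm 1.4, m = 2n, K^{av} ⊇ F] R|Γ_{K''} ≅ r_ι(Π) with Π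
cuspidal REGULAR algebraic on GL_{2n}(𝔸_{K''}) for a CM K''/K linearly disjoint from F ⇒ [R|Γ_{K''}
≅ R|Γ_{K''} ⊗ η_{F''/K''}, unramified local–global compatibility, Jacquet–Shalika,
ArthurClozelAMS120 Ch.3 Thm 4.2(b)] Π is (weakly) automorphically induced from a cuspidal π'' on
GL_n(𝔸_{F''}), F'' = FK'' a quadratic NON-CM extension of the CM field K'' ⇒ contradiction with the
TYPED crux RegularInductionForcesCM (Patrikis2019 Rem. 2.4.8 made a theorem: a regular algebraic
cuspidal representation of GL_{2n} over a CM field is never induced from a non-CM quadratic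
extension — because, by Henniart2012 + Jacquet–Shalika, Π_∞ = ⊗ (π''_{w₁} × π''_{w₂}) and, by the
TYPED crux InfinityTypeDescent = Patrikis2019 Prop. 2.4.7 (Clozel1990 Thm 3.13), the infinity type
of π'' descends to (F'')_cm = K'', so every exponent of Π_∞ is doubled). The exotic weights are what
make Ind ρ regular, regularity is what lets potential automorphy in, and automorphy is what forbids
exotic weights.

TYPED one-line Props (Sketch2.lean in the planner folder, imports Mathlib +
Summits.Langlands.Statement, lean check rc 0 on 2026-08-15; the Assembly is proved there as a sanity
check): RegularInductionForcesCM, InfinityTypeDescent, Assembly — see the items. Constants used (all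
`lean search --decl`-verified):
Literature.NumberTheory.Automorphic.{isCompact_glFiniteIntegralLevel, CuspidalAutomorphicRepData,
AutomorphicRepData.HasSatakeParamAt / HasInfinityType / IsRegularAlgebraic / IsLAlgebraic,
satakePolynomial, InfinityType(.IsRegular/.IsCAlgebraic/.IsLAlgebraic), ArchWeight.a},
Literature.NumberTheory.GaloisRepresentations.FramedGaloisRep(.toGaloisRep),
Summit.Langlands.{ReciprocityData, AutomorphicToGalois, IsGeometricFramed, Corresponds},
NumberField.{IsCMField, IsTotallyReal, IsTotallyComplex, RingOfIntegers},
IsDedekindDomain.HeightOneSpectrum(.under, .asIdeal), Ideal.inertiaDeg, PadicAlgCl, Langlands.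
Skeleton: Assembly := ∀ InSector, (∀ F ℓ n ρ, ¬ InSector F ℓ n ρ) → (∀ F, ∃ Rec, ∀ n > 0, ∀ hcpt,
AutomorphicToGalois n Rec hcpt ∧ ∀ ℓ ι ρ, irreducible → geometric → ¬ InSector F ℓ n ρ → ∃ π
L-algebraic cuspidal, Corresponds Rec ι π ρ) → Langlands.

Rationale: WHY THIS LINE. Over a number field that is neither CM nor totally real no construction of
automorphic Galois representations exists (ShimuraVarietyRealizationBarrier) and, dually, no engine
at all bears on direction (B); the ledger's three purity/uniformity cards record exactly this void.
The card's move is the one functorial operation that LEAVES such a field toward a CM one — induction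
to F_cm — and the observation that the forbidden ("exotic") Hodge–Tate configuration of Patrikis2019
Conj. 3.2.5(1) is precisely what makes the induced representation regular, hence eligible for the
non-polarisable single-representation potential automorphy of Qian2022 (Invent. Math. 231; inputs
ACCGHLNSTT2023 Thm 6.1.2, HLTT/Scholze), after which Arthur–Clozel un-induction (ArthurClozelAMS120
Ch. 3 Thm 4.2(b), Henniart2012) and Clozel–Patrikis descent of infinity types (Clozel1990 Thm 3.13 ⇒
Patrikis2019 Prop. 2.4.7) contradict regularity. Template: Calegari2010/Calegari2011 (functorial
move + potential automorphy + archimedean constraint ⇒ non-existence), with complex conjugation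
replaced by the fibres of Hom(F, ℚ̄_ℓ) → Hom(F_cm, ℚ̄_ℓ). Imported area: automorphy lifting over CM
fields (used strictly inside the Qian import, over the CM field, never over F). Catalogue entry
used: none of the cross-field menu (spectral/probabilistic/physical) applies; this is an
intra-Langlands functorial transplant, stated as such.
PLANNER'S CORRECTION TO THE CARD (NOTES.md §Local): Qian's theorem needs Ind ρ ORDINARY in the
full-flag sense at every w | ℓ of the CM base. For exotic ρ this FAILS at every w that does not
split in F/K (a Γ_{K_w}-stable line would have equal weights at τ and τσ) and no CM enlargement
repairs it; at split w it holds iff the interleaving pattern of the two weight sets is constant over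
Hom(K_w, ℚ̄_ℓ). Hence the sector killed is "exotic ∧ ordinary ∧ ℓ-split ∧ nested ∧ residually big" —
thin for a lone ρ, but for a COMPATIBLE SYSTEM one ordinary prime ℓ split completely in F suffices
(conditions (iv)–(v) vacuous), which is the clean corollary (n = 2: full descent HT_τ = HT_{τσ}).
TWO-LAYER PLAN. Layer 1 (filed now): the import as crux #2, the residual-image crux #3, the
synthesis theorem #4, and the two TYPED automorphic cruxes #5–#6 that provers can attack today;
support items record the local lemma, the totally-real-base reduction, the complement and the
harvest. Layer 2 (glue, filed only when a crux closes): (a) Mackey/induction bookkeeping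
(HT_{τ₀}(Ind) = HT_τ ⊔ HT_{τσ}; Ind of de Rham is de Rham; irreducibility from ρ ≇ ρ^σ); (c)
un-induction: R ≅ R ⊗ η + unramified compatibility + Chebotarev ⇒ Satake(Π ⊗ η) = Satake(Π) a.e. ⇒
Jacquet–Shalika ⇒ Π ≅ Π ⊗ η ⇒ AC 4.2(b) (tree: ArthurClozel1989_inducedLift_of_twist_eq, L² model,
to be bridged to the Borel–Jacquet model via IsAssociatedL2) ⇒ the weak-AI Satake relation of
RegularInductionForcesCM; (d) "FK'' is a quadratic non-CM extension of K''" (linear disjointness;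
subfields of CM fields are CM or totally real).
RANKED CRUXES. #2 QianPotentialAutomorphyInput — the unproved-in-tree import, filed FIRST per the
crux-first rule; informal until IsOrdinaryRegularAt / IsEnormous / IsDecomposedGeneric / residual
representation land (definition requests), cite workitem filed. #3 InducedImageEnormous — Qian's
residual hypotheses for INDUCED images: provably false when F ⊆ K(ζ_ℓ) (block-diagonal image kills
condition (3) of "enormous" on Hom(ρ̄, ρ̄^σ) ⊕ Hom(ρ̄^σ, ρ̄)); otherwise rests on anti-diagonal
regular semisimple elements — GAP check for (SL₂(𝔽_ℓ) × SL₂(𝔽_ℓ)) ⋊ 2 ⊂ GL₄, ℓ = 5, 7 first. #4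
NoOrdinaryExoticRho — the synthesis theorem X_exo (informal until labelled HT weights land). #5
RegularInductionForcesCM (TYPED) — Patrikis Rem. 2.4.8 as a theorem at Satake level; Lean route:
land Henniart AI + Jacquet–Shalika as named facts, then prove from #6. #6 InfinityTypeDescent
(TYPED) — Patrikis Prop. 2.4.7 for regular C- /L-algebraic cuspidal π over totally complex L; first
Lean rung (needs Clozel Thm 3.13 as a named fact; its Aut(ℂ)-stability of cuspidal cohomology is
Franke's theorem).
KILL CRITERIA. (K1) A reading of Qian2022 §1/§4 or ACCGHLNSTT2023 Thm 6.1.2 exposing a hypothesis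
that excludes induced ("union-shaped") weights or imprimitive residual images ⇒ #2 dies, close as
refuted:QianPotentialAutomorphyInput unless a compatible-system version (ACC+ §7 potential
automorphy of systems) rescues the corollary. (K2) #3 refuted for all ℓ (no enormous imprimitive
subgroups of this shape) ⇒ the sector is EMPTY of content; close exhausted. (K3) #5 refuted as typed
(normalisation) ⇒ restate once; refuted mathematically (a regular algebraic cuspidal Π on GL_{2n}/K
CM induced from non-CM L) ⇒ Patrikis's remark is wrong and the whole line dies. (K4) If grounders
show the killed sector is disjoint from every (F, n, ℓ) anyone can name (e.g. no ordinary exotic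
candidates survive ℓ-split + nested for n = 2 over ℚ(2^{1/4}, i)), demote to dormant.
DELIBERATELY NOT DECOMPOSED: the glue (a), (c), (d) above; removal of ordinarity (card crux S2:
density of ordinary primes / a Fontaine–Laffaille single-ρ potential automorphy theorem — a
different route if ever); the parity corollary in odd rank over totally real fields (card: recorded,
not claimed); mixed (partially overlapping) fibres for n ≥ 3; anything over fields with [F : F_cm] >
2.
NOVELTY and BARRIERS: see the dedicated sections (passed as --novelty / --barriers).

Novelty: NEAREST PRIOR ART (searched, 2026-08-15; card + audit searches re-run where the services answered):
Patrikis2019 = arXiv:1207.6724 (read chunks 24, 50–51: Prop. 2.4.7 "cmdescent" — infinity types of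
REGULAR C- /L-algebraic cuspidal π descend to F_cm, unconditional via Clozel1990 Thm 3.13; Rem. 2.4.8
— "F CM, π regular algebraic cuspidal, π = Ind_L^F π₀ ⇒ L is CM", the automorphic mirror; Conj.
3.2.5(1) "galoisdescent" — HT_τ(ρ) depends only on τ|F_cm, called "extremely difficult to establish
for an abstract Galois representation"; Lemma 3.2.6 — automorphic case only); Qian2022 =
arXiv:2104.09761 = doi:10.1007/s00222-022-01161-6 (read pp. 1–3: Thm 1.4, single-r ordinary
potential automorphy over CM fields, no weight-shape and no residual-automorphy hypothesis; no
non-existence corollary stated); ACCGHLNSTT2023 = arXiv:1812.09999 Rem. 6.1.3 (conjugate-symmetry of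
weights forced by ordinary automorphy, needs residual automorphy); Calegari2010
(doi:10.1007/s00222-010-0297-0) / Calegari2011 (JAMS) — the template "functorial move + potential
automorphy + archimedean constraint ⇒ non-existence" for EVEN representations; CaraianiLehung2016
(signs). Searches: crossref "Hodge-Tate weights non-CM field potential automorphy induced
representation" (8 rows, none Galois-side over non-CM F: Shimizu 2018 constancy of generalized HT
weights, Guerberoff–Park 2019, Bartlett 2024 — unrelated); zbMATH "Qian potential automorphy GL(n)"
(1 row = the import); lit galaxy --star all "maximal CM subfiel  [refs: 10.1007/s00222-022-01161-6, 10.1007/s00222-010-0297-0, 1207.6724, 2104.09761, 1812.09999, doi:10.1007/s00222-022-01161-6, doi:10.1007/s00222-010-0297-0, Patrikis2019, Clozel1990, Qian2022, ACCGHLNSTT2023, Calegari2010, Calegari2011, CaraianiLehung2016]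

Barriers (technique_class: potential-automorphy automorphic-induction patching): technique_class: potential-automorphy automorphic-induction patching
Literature.Barriers.Langlands.ShimuraVarietyRealizationBarrier: F is neither CM nor totally real,
where the barrier forbids every known construction; evaded because NOTHING is constructed over F — ρ
is moved by induction to the CM field K = F_cm, where the barrier's recorded evasions (HLTT/Scholze,
then ACC+/Qian2022) live, and the conclusion pulled back to F is a NON-existence statement.
Literature.Barriers.Langlands.NonRegularWeightBarrier: respected and USED, not evaded: exotic
weights are exactly what makes Ind ρ regular (so regular-weight patching applies inside the import)
while descended weights make Ind ρ irregular (so it does not) — the barrier line is the line between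
the sector this route empties and the sector it leaves to OffSectorReciprocity.
Literature.Barriers.Langlands.SolvableImageBarrier: not met: the only automorphic induction / base
change used is along the QUADRATIC extensions F/K and FK''/K'' (the theorem side of the barrier:
cyclic prime degree, ArthurClozelAMS120 Thm 4.2(b), Henniart2012); no representation of insoluble
image is descended, and Qian's potential automorphy supplies K''/K Galois but is consumed only
through restriction, never through non-solvable descent.
Literature.Barriers.Langlands.SolvableImageBarrierNarrow: same reason: the token
automorphic-induction refers to AI along a quadratic extension only; the output is a non-existence
statement, not strong Artin or descent

History (route lifecycle, newest last):
- 2026-08-15T11:03:11Z · rev 1: dropped stmt-Langlands-2301 — drop informal Target filed with an editing slip in its text; re-added clean immediately (planner-plancard-Langlands-Langlands-self-def-df5498df-0)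

sub-problem: Langlands · status: open · opened planner-plancard-Langlands-Langlands-self-def-df5498df-0 2026-08-15T11:02:34Z · rev 3 · ledger route-Langlands-SelfDefeatingInduction
GENERATED by the gate from the ledger (D-0016/17). Provers cite these decls: `theorem foo : Summit.Langlands.Langlands.Theses.SelfDefeatingInduction.<Decl> := …` in Summits/Langlands/Langlands/Theorems/<Name>.lean.
-/

namespace Summit.Langlands.Langlands.Theses.SelfDefeatingInduction

open scoped BigOperators Topology Manifold Classical MeasureTheory ProbabilityTheory Matrix InnerProductSpace ComplexConjugate ContinuousMap
open Filter Set Function TopologicalSpace MeasureTheory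

attribute [summit_statement] _root_.Langlands

-- item stmt-Langlands-2377 · target · rank 0 · open · by planner — informal only, no Lean statement yet:
--   [target] THESIS X = NoOrdinaryExoticRho AND OffSectorReciprocity (informal until labelled Hodge-Tate
--   weights, IsOrdinaryRegularAt, induction of framed Galois representations and IsEnormous land;
--   definition requests filed on this route). SETTING: K a CM field, F/K quadratic with F NOT CM (so
--   F_cm = K), sigma the generator of Gal(F/K), rho : Gamma_F -> GL_n(Qbar_l) irreducible geometric, n
--   >= 1. A fibre {tau, tau sigma} of Hom(F, Qbar_l) -> Hom(K, Qbar_l) is DESCENDED if HT_tau(rho) =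
--   HT_{tau sigma}(rho) and EXOTIC if HT_tau(rho), HT_{tau sigma}(rho) are disjoint (for n <= 2 every
--   fibre is one o

-- item stmt-Langlands-2505 · crux · rank 2 · open · by planner — informal only, no Lean statement yet:
--   [crux] THE IMPORT, filed FIRST per the crux-first rule (an unproved-in-tree named fact; cite
--   workitem filed to land it in Literature once IsOrdinaryRegularAt / IsEnormous / IsDecomposedGeneric
--   / residual representation exist, definition requests on this route). Qian2022 = Invent. Math. 231
--   (2023) 1239-1275 = arXiv:2104.09761, Thm 1.4, EXACTLY AS CONSUMED: K an (imaginary) CM field, K^av/K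
--   a finite extension, m >= 2, l prime, iota : Qbar_l = C, R : Gamma_K -> GL_m(Qbar_l) continuous with
--   (i) R unramified almost everywhere; (ii) for each place w | l of K, R|Gamma_{K_w} potentially
--   semistable and

-- item stmt-Langlands-2509 · crux · rank 3 · open · by planner — informal only, no Lean statement yet:
--   [crux] QIAN'S RESIDUAL HYPOTHESES FOR INDUCED IMAGES (non-vacuity of the sector). Let l be an odd
--   prime, k/F_l finite, F/K a quadratic extension of number fields with generator sigma, rhobar :
--   Gamma_F -> GL_n(k) continuous, Rbar := Ind_{Gamma_F}^{Gamma_K} rhobar : Gamma_K -> GL_{2n}(k). CLAIM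
--   (A), the positive half: if (a) rhobar(Gamma_{F(zeta_l)}) contains a conjugate of SL_n(k_0) for a
--   subfield k_0 with #k_0 > 2n+1 (or any standard 'enormous' big-image hypothesis on rhobar itself,
--   ACC+ arXiv:1812.09999 Lemma 6.2.29-type), (b) rhobar^sigma is not isomorphic to rhobar tensor chi
--   for any charac

-- item stmt-Langlands-2512 · crux · rank 4 · open · by planner — informal only, no Lean statement yet:
--   [crux] THE ROUTE'S THEOREM X_exo (synthesis; informal until LabelledHodgeTateWeights /
--   IsOrdinaryRegularAt / FramedGaloisRep induction / IsEnormous land). Let K be a CM field, F/K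
--   quadratic with F not CM, sigma the generator, n >= 1, l prime, rho : Gamma_F -> GL_n(Qbar_l)
--   continuous, irreducible, unramified almost everywhere, de Rham at v | l. Suppose (ii) for every v |
--   l, rho|Gamma_{F_v} is ordinary with regular Hodge-Tate weights (Qian2022 Def. 1.2); (iii) EXOTIC:
--   HT_tau(rho) and HT_{tau sigma}(rho) are disjoint for every tau : F -> Qbar_l; (iv) l-SPLIT: every
--   place w | l of K splits in F, w

/-- item stmt-Langlands-2235 · crux · rank 5 · open · by planner
why it might fail: As typed the a.e. Satake relation must pin P_infinity: true by Jacquet-Shalika + Henniart's strong AI only if both sides carry the tree's unitary Satake normalisation (a half-twist slip makes it vacuous, not false); n odd needs |det|^{1/2} bookkeeping (pi L- not C-algebraic); rests on Clozel 3.13.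
sources: Patrikis2019, arXiv:1207.6724, Henniart2012, JacquetShalikaAJM1981II, ArthurClozelAMS120, Clozel1990
[crux] REGULAR AUTOMORPHIC INDUCTION TO A CM FIELD FORCES THE INDUCING FIELD TO BE CM (Patrikis2019
Rem. 2.4.8 made a theorem; automorphic side only; weak = Satake-level induction). K CM, L/K
quadratic, L NOT CM (so L_cm = K), n >= 1, P cuspidal on GL_{2n}(A_K), pi cuspidal on GL_n(A_L)
with, for almost all v, prod_{a in alpha_P(v)}(X - a) = prod_{w | v} prod_{b in
beta_pi(w)}(X^{f(w|v)} - b) (Arthur-Clozel (6.1)-(6.2): union at split v, square roots at inert v;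
unitary normalisation of HasSatakeParamAt; n = 1 shape = automorphicInduction_character). THEN P is
not regular algebraic. Printed ingredients: Henniart2012 (global AI compatible at ALL places: at the
complex places of K, all split in L, AI(pi)_v = pi_{w1} x pi_{w2}) + Jacquet-Shalika (P = AI(pi)) =>
a-multiset of P at sigma = a(pi,sigma1) + a(pi,sigma2) (sigma_i the extensions of sigma to L) => P
regular C-algebraic forces pi regular and C-algebraic (n even) or L-algebraic (n odd, exponents in
1/2+Z) => InfinityTypeDescent (sigma1, sigma2 agree on every CM/TR subfield of L, all inside L_cm =
K) gives a(pi,sigma1) = a(pi,sigma2) => every exponent of P doubled: not regular (n > 0). USE: last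
arrow of NoOrdinaryExoticRho with -/
@[route_item "route-Langlands-SelfDefeatingInduction"]
def RegularInductionForcesCM : Prop :=
  ∀ (K L : Type) [Field K] [NumberField K] [Field L] [NumberField L] [Algebra K L], NumberField.IsCMField K → ¬ NumberField.IsCMField L → Module.finrank K L = 2 → ∀ (n : ℕ), 0 < n → ∀ (hK : Literature.NumberTheory.Automorphic.isCompact_glFiniteIntegralLevel (2 * n) K) (hL : Literature.NumberTheory.Automorphic.isCompact_glFiniteIntegralLevel n L) (P : Literature.NumberTheory.Automorphic.CuspidalAutomorphicRepData (2 * n) K hK) (π : Literature.NumberTheory.Automorphic.CuspidalAutomorphicRepData n L hL), (∀ᶠ v : IsDedekindDomain.HeightOneSpectrum (NumberField.RingOfIntegers K) in Filter.cofinite, ∃ (α : Multiset ℂ) (β : IsDedekindDomain.HeightOneSpectrum (NumberField.RingOfIntegers L) → Multiset ℂ), P.1.HasSatakeParamAt v α ∧ (∀ w : IsDedekindDomain.HeightOneSpectrum (NumberField.RingOfIntegers L), w.under (NumberField.RingOfIntegers K) = v → π.1.HasSatakeParamAt w (β w)) ∧ Literature.NumberTheory.Automorphic.satakePolynomial α =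 ∏ᶠ w ∈ {w : IsDedekindDomain.HeightOneSpectrum (NumberField.RingOfIntegers L) | w.under (NumberField.RingOfIntegers K) = v}, (Literature.NumberTheory.Automorphic.satakePolynomial (β w)).comp (Polynomial.X ^ w.asIdeal.inertiaDeg (NumberField.RingOfIntegers K))) → ¬ P.1.IsRegularAlgebraic

/-- item stmt-Langlands-2236 · crux · rank 6 · open · by planner
why it might fail: Known only for REGULAR pi (Patrikis: conjectural otherwise) via Clozel Thm 3.13, whose Aut(C)-stability of cuspidal cohomology over general L leans on Franke; as typed, 'agree on every CM/TR subfield' must equal 'agree on L_cm' (compositum argument); HasInfinityType reads a-multisets only.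
sources: Patrikis2019, arXiv:1207.6724, Clozel1990, Literature.NumberTheory.Automorphic.AutomorphicRepData.HasInfinityType, Literature.NumberTheory.Automorphic.InfinityType.IsRegular
[crux] DESCENT OF INFINITY TYPES (Patrikis2019 Prop. 2.4.7 = arXiv:1207.6724 'cmdescent';
unconditional for REGULAR pi by Clozel1990 Thm 3.13; higher-rank form of Weil 1956). L totally
complex, pi cuspidal on GL_n(A_L) with an infinity type T regular and C- or L-algebraic; if sigma1,
sigma2 : L -> C agree on every CM or totally real subfield of L (equivalently on L_cm, their
compositum), then the multisets of z-exponents {a_i} of T at sigma1, sigma2 coincide. Printed proof: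
Q(pi_f) is a CM number field E (Clozel 3.13 + unitarity, Patrikis Cor. 2.4.6); Aut(C/E~) fixes pi,
hence its infinity type, and acts transitively on the embeddings of L above a fixed embedding of
L_cm. ROLE: the archimedean constraint of the line (what Taylor's sign theorem is to Calegari's
even-representation argument) and the route's first Lean rung: land Clozel Thm 3.13
(sigma-conjugates of regular algebraic cuspidal pi with conjugated infinity type; Q(pi_f) a number
field) as a Literature named fact, prove CM-ness of Q(pi_f) and this descent in Theorems; expect a
restate (h : Clozel313) -> ... HasInfinityType pins exactly the a-multisets (infinitesimal
character), which is all that is claimed. -/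
@[route_item "route-Langlands-SelfDefeatingInduction"]
def InfinityTypeDescent : Prop :=
  ∀ (L : Type) [Field L] [NumberField L], NumberField.IsTotallyComplex L → ∀ (n : ℕ) (hL : Literature.NumberTheory.Automorphic.isCompact_glFiniteIntegralLevel n L) (π : Literature.NumberTheory.Automorphic.CuspidalAutomorphicRepData n L hL) (T : Literature.NumberTheory.Automorphic.InfinityType L n), π.1.HasInfinityType T → T.IsRegular → (T.IsCAlgebraic ∨ T.IsLAlgebraic) → ∀ σ₁ σ₂ : L →+* ℂ, (∀ M : Subfield L, (NumberField.IsCMField M ∨ NumberField.IsTotallyReal M) → ∀ x ∈ M, σ₁ x = σ₂ x) → (T σ₁).map Literature.NumberTheory.Automorphic.ArchWeight.a = (T σ₂).map Literature.NumberTheory.Automorphic.ArchWeight.a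

-- item stmt-Langlands-2514 · support · rank 9 · open · by planner — informal only, no Lean statement yet:
--   [support] THE LOCAL LEMMA (planner's correction to the card; decidable filtered-module algebra,
--   informal until IsOrdinaryRegularAt and induction land). Let F/K be a quadratic extension of number
--   fields with generator sigma, rho : Gamma_F -> GL_n(Qbar_l) with rho|Gamma_{F_v} ordinary with
--   regular Hodge-Tate weights (Qian2022 Def. 1.2) for every v | l, and EXOTIC (HT_tau(rho), HT_{tau
--   sigma}(rho) disjoint for all tau). Let R := Ind_{Gamma_F}^{Gamma_K} rho and w | l a place of K. (a)
--   NON-SPLIT w (one place v of F above w): R|Gamma_{K_w} =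
--   Ind_{Gamma_{F_v}}^{Gamma_{K_w}}(rho|Gamma_{F_v}) has NO Ga

-- item stmt-Langlands-2519 · support · rank 9 · open · by planner — informal only, no Lean statement yet:
--   [support] REDUCTION OF THE TOTALLY-REAL-BASE CASE TO THE CM-BASE CASE (glue-level; informal). Let F
--   be a number field that is neither CM nor totally real and F_0 an index-2 subfield that is TOTALLY
--   REAL (then F_0 = F_cm), F = F_0(sqrt(alpha)), sigma the generator of Gal(F/F_0), rho : Gamma_F ->
--   GL_n(Qbar_l) irreducible geometric satisfying, relative to F/F_0: ordinary with regular weights at v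
--   | l, exotic, every place u | l of F_0 SPLIT in F, nested at each u (word constant on Hom(F_{0,u},
--   Qbar_l)), and big residual image in the sense of InducedImageEnormous (a)-(b) for rhobar. CLAIM:
--   there is

-- item stmt-Langlands-2520 · support · rank 9 · open · by planner — informal only, no Lean statement yet:
--   [support] THE COMPLEMENT X_rest (the rest of the mountain; shared in substance with every other
--   Langlands route; informal until the sector predicate is typed). STATEMENT: for every number field F
--   there are reciprocity data Rec (local Langlands data at every finite place and p-adic Hodge data at
--   v | l, as in Statement.lean) such that for every n >= 1 and hcpt: (A) AutomorphicToGalois n Rec hcpt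
--   holds verbatim, and (B') for every prime l, iota : Qbar_l = C and every irreducible geometric rho :
--   Gamma_F -> GL_n(Qbar_l) that is NOT in the sector S(F, l, n) there is an L-algebraic cuspidal pi
--   with C

-- item stmt-Langlands-2521 · support · rank 9 · open · by planner — informal only, no Lean statement yet:
--   [support] HARVEST (card part II, endorsed by the novelty audit; same import WITHOUT the induction
--   move; informal until labelled weights / IsOrdinaryRegularAt / IsEnormous land). Let K be a CM field
--   with complex conjugation c, n >= 2, rho : Gamma_K -> GL_n(Qbar_l) irreducible, unramified a.e.,
--   ordinary with regular Hodge-Tate weights at every v | l (Qian2022 Def. 1.2), with rhobar absolutely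
--   irreducible, decomposed generic, rhobar(Gamma_{K(zeta_l)}) enormous and a scalar rhobar(sigma) for
--   some sigma outside Gamma_{K(zeta_l)}. THEN the labelled weights are CONJUGATE-SYMMETRIC: there is an
--   intege

/-- item stmt-Langlands-2237 · assembly · rank 1 · open · by planner
sources: Summits/Langlands/Langlands/Statement.lean
SECTOR SPLIT (logical skeleton, provable now: Sketch2.lean `assembly_holds`). For ANY predicate
InSector on irreducible geometric rho: (no rho lies in the sector) -> (the summit with clause (B)
demanded only off the sector, (A) unchanged, same reciprocity data Rec) -> Langlands, by a case
split on rho. The content of the route is the instance InSector := 'rho is exotic, ordinary with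
regular weights, l-split, nested, with Qian-big induced residual image, over a non-CM quadratic
extension of a CM field' - items NoOrdinaryExoticRho (emptiness, crux #4) and OffSectorReciprocity
(the complement = the rest of the mountain, support), both informal until labelled Hodge-Tate
weights / IsOrdinaryRegularAt / induction / IsEnormous land (definition requests filed); at that
point this skeleton specialises verbatim. Deliberately content-free: the gluing of a sector route IS
a case split; refuters should audit the sector's non-vacuity at crux #3 and its relevance at the
Target, not here. -/
@[route_item "route-Langlands-SelfDefeatingInduction"]
def Assembly : Prop :=
  ∀ InSector : (∀ (F : Type) [Field F] [NumberField F] (ℓ : ℕ) [Fact ℓ.Prime] (n : ℕ), Literature.NumberTheory.GaloisRepresentations.FramedGaloisRep F (PadicAlgCl ℓ) n → Prop), (∀ (F : Type) [Field F] [NumberField F] (ℓ : ℕ) [Fact ℓ.Prime] (n : ℕ) (ρ : Literature.NumberTheory.GaloisRepresentations.FramedGaloisRep F (PadicAlgCl ℓ) n), ¬ InSector F ℓ n ρ) → (∀ (F : Type) [Field F] [NumberField F], ∃ Rec : Summit.Langlands.ReciprocityData F, ∀ n : ℕ, 0 < n → ∀ hcpt : Literature.NumberTheory.Automorphic.isCompact_glFiniteIntegralLevel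 n F, Summit.Langlands.AutomorphicToGalois n Rec hcpt ∧ ∀ (ℓ : ℕ) [Fact ℓ.Prime] (ι : PadicAlgCl ℓ ≃+* ℂ) (ρ : Literature.NumberTheory.GaloisRepresentations.FramedGaloisRep F (PadicAlgCl ℓ) n), ρ.toGaloisRep.IsIrreducible → Summit.Langlands.IsGeometricFramed Rec ρ → ¬ InSector F ℓ n ρ → ∃ π : Literature.NumberTheory.Automorphic.CuspidalAutomorphicRepData n F hcpt, π.1.IsLAlgebraic ∧ Summit.Langlands.Corresponds Rec ι π.1 ρ) → Langlands

end Summit.Langlands.Langlands.Theses.SelfDefeatingInduction
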